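import Literature.MathematicalPhysics.QuantumFieldTheory.Balaban1983to89.B9Eq358Decomposition

/-!
# `Balaban1983to89.B9Eq357Locality` — B9 p. 401, the sentence after (3.57): «Let us notice that the above expressions
# involve the gauge field variables U′_b, U_b for b ⊂ Bʲ(y)» — PROVED for the objects of (3.55)–(3.58): the composite
# contour variable U(Γ^{(j)}_{y,x}) (`compT`), the key quantity P = (U′U)(Γ^{(j)}_{y,x})(U(Γ^{(j)}_{y,x}))⁻¹ (`pFac`),
# F′_{2,j}(A; y, x) (`Fp`), (F′_{2,j}(A)λ)(y) (`FpOp`) and (Q′_j(U)λ)(y) (`QpC`) depend on U′, U only through the bond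
# variables of the block Bʲ(y)

HONEST FRAMING (cell `lit-balaban`, verbatim): statement-level skeleton of published theorems with citation tags; proofs
where landed; nothing here is a claim about the Yang–Mills mass gap.

CITATION HEADER (lean-in-tree rule).  T. Bałaban, *Propagators for lattice gauge theories in a background field*, Commun.
Math. Phys. **99** (1985) 389–434 [`Balaban1985BackgroundPropagators`] (cell paper B9; held
`paper:balaban1985-cmp99-background-propagators`, journal page = PDF page + 388), p. 401 [PDF 13] (3.55)–(3.57) and the
sentence after (3.57); read by this seat (r06 gen 24, 2026-08-23) on the render
`b2b-balaban-ref1/pages/1985-cmp99-background-propagators/…-p013-x2.png`.  The locality it records is print's use of T. Bałaban,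
*Averaging operations for lattice gauge theories*, Commun. Math. Phys. **98** (1985) 17–51 [`Balaban1985Averaging`] = [5],
p. 24 «this definition is local in the sense that Ū^k_c … depends only on the bond variables U_b for b ⊂ B^k(c₋) ∪ B^k(c₊)»
(the tree's `B7Prop1Local.avgIter_congr`, `B8Ineq130.agree_level`).  Cell `lit-balaban`, seat r06 (B9 fold owner), SKELETON
row `B9.Eq3.55` (member; the located point of HEAD QUESTION Q-B9-24-2) and row `B9.Eq3.58` (locality member).

WHAT IS PRINTED («…» verbatim, p. 401).  After (3.55)–(3.57) (the expansion of (U′U)(Γ^{(j)}_{y,x}) through the averages,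
typed and proved in `B9Eq358Decomposition`/`B9Eq357Levels`): «Let us notice that the above expressions involve the gauge field
variables U′_b, U_b for b ⊂ Bʲ(y). The jth order averages are considered on Λ_j, hence y ∈ Λ_j, Bʲ(y) ⊂ Ω_j, and A satisfies the
inequality |A| < α₁(Lʲη)⁻¹ on Bʲ(y).»

WHAT IS PROVED (kernel, 0 sorry; NO definition, NO `Prop` fact; nothing of the paper is asserted beyond this locality).
In the unit-lattice coordinates of the [5] files (`B7Prop1Explicit.Site d = ℤᵈ`, level `j` read on `ℤᵈ` after `j` rescalings)
the block `Bʲ(y)` is the coordinate box `[Lʲy, Lʲy + (Lʲ − 1)𝟙]` = the depth-`j` cube `[tlo L y j, thi L y j]` of `B8Ineq130`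
over the one-site cube `[y, y]` (`tlo_apply`/`thi_apply`; `bsite_mem_cube`: every `x = Lʲy + r ∈ Bʲ(y)` lies in it), and
«involve the gauge field variables U_b for b ⊂ Bʲ(y)» only is `B7Prop1Local.AgreeOn (tlo L y j) (thi L y j) U V → (value at U)
= (value at V)`:
* §1 `bsite_mem_cube`, `agreeOn_mul'` (bookkeeping).
* §2 **`tg_avgIter_congr`** — the tower gauge function `tg` of the averages `(Ūˡ)_l` ([5] (43), `avgIter`) at every depth
  `n ≤ j` and every site of the depth-`n` cube depends only on `U` on the bonds of `Bʲ(y)` (induction on the depth: the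
  level-`(j−n)` average is local by `B8Ineq130.agree_level`, the tree transport inside one block by `B8Ineq130.axialFn_congr`,
  the block below a cube site lies in the next cube by `fl_mem`/`smul_mem`); **`compT_congr`** — (3.55)'s `U(Γ^{(j)}_{y,x})`
  (`B9Eq358Decomposition.compT`) for `x ∈ Bʲ(y)`; `compT_congr_bsite`.
* §3 **`pFac_congr`** — P = (U′U)(Γ^{(j)}_{y,x})(U(Γ^{(j)}_{y,x}))⁻¹ of (3.57)/(3.58) for two pairs (U, U′), (V, V′) agreeing on
  the bonds of `Bʲ(y)`; **`Fp_congr`** — F′_{2,j}(A; y, x); **`FpOp_congr`** — (F′_{2,j}(A)λ)(y), which moreover sees `λ` only on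
  `Bʲ(y)`; **`QpC_congr`** — (3.19)'s (Q′_j(U)λ)(y) = Σ_{x∈Bʲ(y)} L^{−jd}R(U(Γ^{(j)}_{y,x}))λ(x) sees `U` and `λ` only on `Bʲ(y)`.
HONEST SCOPE.  Exact algebra/bookkeeping on the [5] `ℤᵈ` carrier of rows B9.Eq3.55/3.58 (the same reading as
`B9Eq358Decomposition`: every level on `ℤᵈ`, `x_{l+1} = fl x_l`); «b ⊂ Bʲ(y)» = bonds with BOTH endpoints in the box (the
`AgreeOn` of `B7Prop1Local`); the second and third printed sentences (the Λ_j/Ω_j placement and the rescaling A′ = LʲηA) are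
conventions of the Sect. B files and are not restated; no estimate.
-/

noncomputable section

namespace Literature.MathematicalPhysics.QuantumFieldTheory.Balaban1983to89.B9Eq357Locality

open B7Prop1Explicit B7Prop2Explicit B7Prop1Local B8Eq115GaugeFixing B9Eq358Decomposition
open B8Ineq130 (fl tlo thi tlo_apply thi_apply agree_level fl_mem smul_mem axialFn_congr inBox_of_le)
open B7Eq78Linearization (conjR)

variable {d : ℕ}

/-! ## §1 The block `Bʲ(y)` as the depth-`j` cube over the one-site cube `[y, y]` -/

section Cube

variable (L : ℕ)

/-- every site `x = Lʲy + r` of `Bʲ(y)` (`B9Eq358Decomposition.bsite`, `r ∈ [0, Lʲ)ᵈ`) lies in the depth-`j` cube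
`[tlo L y j, thi L y j] = [Lʲy, Lʲ(y + 𝟙) − 𝟙]`. [cite: Balaban1985BackgroundPropagators, (3.19) p.393, p.401 (sentence after (3.57))] -/
theorem bsite_mem_cube (j : ℕ) (y : B7Prop1Explicit.Site d) (r : Fin d → Fin (L ^ j)) :
    tlo L y j ≤ bsite L j y r ∧ bsite L j y r ≤ thi L y j := by
  constructor
  · intro i
    rw [tlo_apply]
    simp only [bsite, boxVec, Pi.add_apply, Pi.smul_apply, smul_eq_mul]
    have h0 : (0 : ℤ) ≤ ((r i : ℕ) : ℤ) := by positivity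
    linarith
  · intro i
    rw [thi_apply]
    simp only [bsite, boxVec, Pi.add_apply, Pi.smul_apply, smul_eq_mul]
    have h1 : ((r i : ℕ) : ℤ) + 1 ≤ (L : ℤ) ^ j := by
      have := (r i).isLt
      exact_mod_cast this
    linarith

variable {G : Type*} [Group G]

/-- products of agreeing pairs agree (bookkeeping for the product configuration `U′U`). [folklore] -/
private theorem agreeOn_mul' {lo hi : B7Prop1Explicit.Site d} {V V' W W' : B7Prop1Explicit.Site d → Fin d → G} (hV : AgreeOn lo hi V V')
    (hW : AgreeOn lo hi W W') : AgreeOn lo hi (V * W) (V' * W') := fun x κ hx hx' => by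
  simp only [Pi.mul_apply, hV x κ hx hx', hW x κ hx hx']

end Cube

/-! ## §2 Locality of the composite contour variable `U(Γ^{(j)}_{y,x})` of (3.55) -/

section Transport

variable (L : ℕ) {𝔸 : Type*} [NormedRing 𝔸] [NormedAlgebra ℂ 𝔸] [CompleteSpace 𝔸]

/-- **the tower gauge function of the averages is local in the block**: if `U` and `V` agree on the bonds of `Bʲ(y)`
(the depth-`j` cube over `[y, y]`), then for every depth `n ≤ j` and every site `x` of the depth-`n` cube the transporters
`tg L (Ūˡ)_l j y n x` built from the averages `Ūˡ = avgIter L U l` and from `V̄ˡ` coincide — [5] p. 24 locality of `Ūˡ`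
(`B8Ineq130.agree_level`) + locality of the tree transport in one block (`B8Ineq130.axialFn_congr`), level by level.
[cite: Balaban1985BackgroundPropagators, p.401 (sentence after (3.57)); Balaban1985Averaging, p.24 (sentence after (43))] -/
theorem tg_avgIter_congr (hL : 1 ≤ L) {U V : B7Prop1Explicit.Site d → Fin d → 𝔸ˣ} {j : ℕ} {y : B7Prop1Explicit.Site d}
    (h : AgreeOn (tlo L y j) (thi L y j) U V) :
    ∀ n : ℕ, n ≤ j → ∀ x : B7Prop1Explicit.Site d, tlo L y n ≤ x → x ≤ thi L y n →
      tg L (fun l => avgIter L U l) j y n x = tg L (fun l => avgIter L V l) j y n x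
  | 0, _, x, hx, hx' => by
    rw [tg_zero, tg_zero]
    have hA : AgreeOn (tlo L y 0) (thi L y 0) (avgIter L U j) (avgIter L V j) :=
      agree_level hL j 0 (by rwa [Nat.zero_add])
    exact axialFn_congr hA y x (inBox_of_le le_rfl le_rfl) (inBox_of_le hx hx')
  | n + 1, hn, x, hx, hx' => by
    rw [tg_succ, tg_succ]
    obtain ⟨h1, h2⟩ := fl_mem hL hx hx'
    rw [tg_avgIter_congr hL h n (Nat.le_of_succ_le hn) (fl L x) h1 h2]
    congr 1
    have hA : AgreeOn (tlo L y (n + 1)) (thi L y (n + 1)) (avgIter L U (j - (n + 1))) (avgIter L V (j - (n + 1))) :=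
      agree_level hL (j - (n + 1)) (n + 1) (by rwa [show n + 1 + (j - (n + 1)) = j by omega])
    obtain ⟨h3, h4⟩ := smul_mem hL h1 h2
    exact axialFn_congr hA _ _ (inBox_of_le h3 h4) (inBox_of_le hx hx')

/-- **(3.55)'s `U(Γ^{(j)}_{y,x})` involves only the bond variables U_b, b ⊂ Bʲ(y)**: for `x` in the block `Bʲ(y)` (the depth-`j`
cube) the composite contour variable `B9Eq358Decomposition.compT` is the same for any two configurations agreeing on the bonds of
`Bʲ(y)`. [cite: Balaban1985BackgroundPropagators, (3.55) p.401 and the sentence after (3.57)] -/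
theorem compT_congr (hL : 1 ≤ L) {U V : B7Prop1Explicit.Site d → Fin d → 𝔸ˣ} {j : ℕ} {y : B7Prop1Explicit.Site d}
    (h : AgreeOn (tlo L y j) (thi L y j) U V) {x : B7Prop1Explicit.Site d} (hx : tlo L y j ≤ x) (hx' : x ≤ thi L y j) :
    compT L U j y x = compT L V j y x :=
  tg_avgIter_congr L hL h j le_rfl x hx hx'

/-- the same at the block sites `x = Lʲy + r`. [cite: Balaban1985BackgroundPropagators, (3.55) p.401 and the sentence after (3.57)] -/
theorem compT_congr_bsite (hL : 1 ≤ L) {U V : B7Prop1Explicit.Site d → Fin d → 𝔸ˣ} {j : ℕ} {y : B7Prop1Explicit.Site d}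
    (h : AgreeOn (tlo L y j) (thi L y j) U V) (r : Fin d → Fin (L ^ j)) :
    compT L U j y (bsite L j y r) = compT L V j y (bsite L j y r) :=
  compT_congr L hL h (bsite_mem_cube L j y r).1 (bsite_mem_cube L j y r).2

end Transport

/-! ## §3 «the above expressions involve the gauge field variables U′_b, U_b for b ⊂ Bʲ(y)» for P, F′_{2,j}, Q′_j -/

section Expressions

variable (L : ℕ) {𝔸 : Type*} [NormedRing 𝔸] [NormedAlgebra ℂ 𝔸] [CompleteSpace 𝔸]

/-- **P = (U′U)(Γ^{(j)}_{y,x})(U(Γ^{(j)}_{y,x}))⁻¹ of (3.57)/(3.58) involves only U′_b, U_b for b ⊂ Bʲ(y)**: two pairs (U, U′),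
(V, V′) agreeing on the bonds of `Bʲ(y)` give the same `B9Eq358Decomposition.pFac` at every `x ∈ Bʲ(y)`.
[cite: Balaban1985BackgroundPropagators, (3.57) p.401 and the sentence after it] -/
theorem pFac_congr (hL : 1 ≤ L) {U U' V V' : B7Prop1Explicit.Site d → Fin d → 𝔸ˣ} {j : ℕ} {y : B7Prop1Explicit.Site d}
    (hU : AgreeOn (tlo L y j) (thi L y j) U V) (hU' : AgreeOn (tlo L y j) (thi L y j) U' V') {x : B7Prop1Explicit.Site d}
    (hx : tlo L y j ≤ x) (hx' : x ≤ thi L y j) :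
    pFac L U U' j y x = pFac L V V' j y x := by
  rw [pFac, pFac, compT_congr L hL (agreeOn_mul' hU' hU) hx hx', compT_congr L hL hU hx hx']

/-- **F′_{2,j}(A; y, x) involves only U′_b, U_b for b ⊂ Bʲ(y)** (`B9Eq358Decomposition.Fp`, p. 401 «R((U′U)(Γ^{(j)}_{y,x})) =
R(U(Γ^{(j)}_{y,x})) + F′_{2,j}(A; y, x)»). [cite: Balaban1985BackgroundPropagators, (3.58) p.401 and the sentence after (3.57)] -/
theorem Fp_congr (hL : 1 ≤ L) {U U' V V' : B7Prop1Explicit.Site d → Fin d → 𝔸ˣ} {j : ℕ} {y : B7Prop1Explicit.Site d}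
    (hU : AgreeOn (tlo L y j) (thi L y j) U V) (hU' : AgreeOn (tlo L y j) (thi L y j) U' V') {x : B7Prop1Explicit.Site d}
    (hx : tlo L y j ≤ x) (hx' : x ≤ thi L y j) (X : 𝔸) :
    Fp L U U' j y x X = Fp L V V' j y x X := by
  rw [Fp, Fp, compT_congr L hL (agreeOn_mul' hU' hU) hx hx', compT_congr L hL hU hx hx']

/-- **(F′_{2,j}(A)λ)(y) = Σ_{x∈Bʲ(y)} L^{−jd}F′_{2,j}(A; y, x)λ(x) involves only U′_b, U_b for b ⊂ Bʲ(y) and λ on Bʲ(y)**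
(`B9Eq358Decomposition.FpOp`). [cite: Balaban1985BackgroundPropagators, (3.58)–(3.59) p.402 and p.401 (sentence after (3.57))] -/
theorem FpOp_congr (hL : 1 ≤ L) {U U' V V' : B7Prop1Explicit.Site d → Fin d → 𝔸ˣ} {j : ℕ} {y : B7Prop1Explicit.Site d}
    (hU : AgreeOn (tlo L y j) (thi L y j) U V) (hU' : AgreeOn (tlo L y j) (thi L y j) U' V')
    {lam lam' : B7Prop1Explicit.Site d → 𝔸} (hlam : ∀ x, tlo L y j ≤ x → x ≤ thi L y j → lam x = lam' x) :
    FpOp L U U' j lam y = FpOp L V V' j lam' y := by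
  unfold FpOp
  refine Finset.sum_congr rfl fun r _ => ?_
  obtain ⟨h1, h2⟩ := bsite_mem_cube L j y r
  rw [Fp_congr L hL hU hU' h1 h2, hlam _ h1 h2]

/-- **(3.19)'s (Q′_j(U)λ)(y) = Σ_{x∈Bʲ(y)} L^{−jd}R(U(Γ^{(j)}_{y,x}))λ(x) involves only U_b for b ⊂ Bʲ(y) and λ on Bʲ(y)**
(`B9Eq358Decomposition.QpC`). [cite: Balaban1985BackgroundPropagators, (3.19) p.393, p.401 (sentence after (3.57))] -/
theorem QpC_congr (hL : 1 ≤ L) {U V : B7Prop1Explicit.Site d → Fin d → 𝔸ˣ} {j : ℕ} {y : B7Prop1Explicit.Site d}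
    (hU : AgreeOn (tlo L y j) (thi L y j) U V) {lam lam' : B7Prop1Explicit.Site d → 𝔸}
    (hlam : ∀ x, tlo L y j ≤ x → x ≤ thi L y j → lam x = lam' x) :
    QpC L U j lam y = QpC L V j lam' y := by
  unfold QpC
  refine Finset.sum_congr rfl fun r _ => ?_
  obtain ⟨h1, h2⟩ := bsite_mem_cube L j y r
  rw [compT_congr L hL hU h1 h2, hlam _ h1 h2]

end Expressions

end Literature.MathematicalPhysics.QuantumFieldTheory.Balaban1983to89.B9Eq357Locality
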